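import Summits.AtomisticToContinuum.Crystallization.Theorems.FrustratedLawDichotomyShellBadnessCert

/-!
# FrustratedLawDichotomy · crux `AperiodicFrustratedLawGap` (stmt-AtomisticToContinuum-27623) — SHELL FLAG CERTIFICATES, part 1b: BADNESS AT LOOSE
# TOLERANCE (`η ≤ 3/10`, e.g. the `1/8`-badness of T-side witness cells and of crowded-core / icosahedral motifs)
# (decomp-a2c, prover hand 2, structural share, generation 16; sequel of `…ShellBadnessCert`, whose window / five-contacts / eleven certificates
# are stated for `η ≤ 1/20` only)

Setting as in part 1 (`z : Fin M → ℝ³` injective, centre `c`, `q₀ ≤ nn²`, `a₁ ≠ c`).  At a loose tolerance the CNA windows of part 1 close up, but three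
rotation-free tests survive, all resting on `|dist (t u) (t v) − d·dist u v| ≤ 2η'·d` and the integer distance spectrum of the two kissing patterns
(contacts at `1`, everything else `≥ √2`; both patterns `4`-regular):
* `not_goodAt_of_eleven_loose` (`η ≤ 3/10`) — the shell map stays injective (`η' < 1/2`) and below `13/10·d` (`η' < 3/10`), so an index set of `≤ 11`
  elements covering every `a ≠ c` with `|z a − z c|² < 169/100·|z a₁ − z c|²` refutes goodness (vacancies, under-coordination);
* `not_goodAt_of_fiveClose` (any `η` with `2η ≤ s`, `s² ≤ 2`, `s` rational, e.g. `s = 7/5`) — a first-shell atom `j` and five first-shell atoms at squared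
  distance `< (s − 2η)²·q₀` from `z j` (only pattern CONTACTS can be closer than `(√2 − 2η)·d`; there are four): the icosahedral `555` signature
  (twelve neighbours with five shell contacts at `1.0515·d` each) fails this at every `η < (√2 − 1.0515)/2 ≈ 0.18`, in particular at `1/8`;
* `not_goodAt_of_fewContacts` (`η ≤ 3/10`) — a first-shell atom `j` with FEWER than four covered atoms `k ≠ j` at squared distance
  `≤ (1 + 2η)²·|z a₁ − z c|²` (every pattern contact of `j`'s preimage lands there).
All `[folklore]`; 0 sorry; no definitions.
-/

noncomputable section

namespace Summit.AtomisticToContinuum.Crystallization.Theorems.FrustratedLawDichotomyShellBadnessCertLoose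

open scoped BigOperators RealInnerProductSpace
open Literature.Geometry.DiscreteGeometry
open Summit.AtomisticToContinuum.Crystallization.Theorems.ChargedEnergyGapNegative (E3)
open Summit.AtomisticToContinuum.Crystallization.Theorems.FrustratedLawDichotomyRangeCut (GoodAt)
open Summit.AtomisticToContinuum.Crystallization.Theorems.FrustratedLawDichotomyMotifLemmas (GoodAtScale)
open Summit.AtomisticToContinuum.Crystallization.Theorems.FrustratedLawDichotomyMotifDoorE (MaybeGoodAt)
open Summit.AtomisticToContinuum.Crystallization.Theorems.FrustratedLawDichotomyRobustGoodSignature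
  (fcc_contacts hcp_contacts dist_eq_one_or_sqrt_two_le dist_shell_sub_le robustGood_four_contacts_fcc robustGood_four_contacts_hcp)
open Summit.AtomisticToContinuum.Crystallization.Theorems.FrustratedLawDichotomyTextureFineShells
  (fccKissingPattern_nonempty hcpKissingPattern_nonempty)
open Summit.AtomisticToContinuum.Crystallization.Theorems.FrustratedLawDichotomyShellBadnessCert
  (radial_window eta_nonneg scale_le_dist lower_le_scale_sq mem_range_of_sq_lt)

/-! ## §1. Pattern facts: distance spectrum `{1} ∪ [√2, 2]` and four contacts, at the PATTERN level -/

/-- fcc: two distinct pattern points are at distance `1` or `≥ √2`. [folklore] -/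
theorem fcc_dist_one_or_sqrt_two_le (u v : ↥fccKissingPattern) (huv : u ≠ v) :
    dist (u : E3) v = 1 ∨ Real.sqrt 2 ≤ dist (u : E3) v := by
  obtain ⟨a, ha, hau⟩ := Finset.mem_image.1 u.2
  obtain ⟨b, hb, hbv⟩ := Finset.mem_image.1 v.2
  have hab : b ≠ a := by
    rintro rfl; exact huv (Subtype.ext (by rw [← hau, ← hbv]))
  have hS : ∀ v ∈ fccInt, ∀ w ∈ fccInt, w ≠ v → sqNormInt (v - w) = (2 : ℕ) ∨ 2 * ((2 : ℕ) : ℤ) ≤ sqNormInt (v - w) :=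
    fun v hv w hw hwv => by
      rcases (fcc_contacts v hv).2 w hw hwv with h | h
      · exact Or.inl (by exact_mod_cast h)
      · exact Or.inr (by push_cast; omega)
  rcases dist_eq_one_or_sqrt_two_le (S := fccInt) (N := 2) two_ne_zero hS ha hb hab with ⟨-, h⟩ | ⟨-, h⟩
  · left; rwa [hau, hbv] at h
  · right; rwa [hau, hbv] at h

/-- hcp: two distinct pattern points are at distance `1` or `≥ √2`. [folklore] -/
theorem hcp_dist_one_or_sqrt_two_le (u v : ↥hcpKissingPattern) (huv : u ≠ v) :
    dist (u : E3) v = 1 ∨ Real.sqrt 2 ≤ dist (u : E3) v := by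
  obtain ⟨a, ha, hau⟩ := Finset.mem_image.1 u.2
  obtain ⟨b, hb, hbv⟩ := Finset.mem_image.1 v.2
  have hab : b ≠ a := by
    rintro rfl; exact huv (Subtype.ext (by rw [← hau, ← hbv]))
  have hS : ∀ v ∈ hcpInt, ∀ w ∈ hcpInt, w ≠ v → sqNormInt (v - w) = (18 : ℕ) ∨ 2 * ((18 : ℕ) : ℤ) ≤ sqNormInt (v - w) :=
    fun v hv w hw hwv => by
      rcases (hcp_contacts v hv).2 w hw hwv with h | h
      · exact Or.inl (by exact_mod_cast h)
      · exact Or.inr (by push_cast; omega)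
  rcases dist_eq_one_or_sqrt_two_le (S := hcpInt) (N := 18) (by norm_num) hS ha hb hab with ⟨-, h⟩ | ⟨-, h⟩
  · left; rwa [hau, hbv] at h
  · right; rwa [hau, hbv] at h

/-- fcc: every pattern point has exactly four pattern points within `11/10` (its contacts) — pattern-level form of
`robustGood_four_contacts_fcc` (shell map = inclusion, `d = 1`, `η = 0`). [folklore] -/
theorem fcc_four_contacts (u : ↥fccKissingPattern) : Nat.card {v : ↥fccKissingPattern // v ≠ u ∧ dist (u : E3) v ≤ 11 / 10} = 4 := by
  have h := robustGood_four_contacts_fcc (p := 0) (d := 1) (η := 0) one_pos (by norm_num) (A := LinearIsometry.id)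
    (t := fun u : ↥fccKissingPattern => (u : E3)) (fun u => by simp) u
  simpa using h

/-- hcp: every pattern point has exactly four pattern points within `11/10`. [folklore] -/
theorem hcp_four_contacts (u : ↥hcpKissingPattern) : Nat.card {v : ↥hcpKissingPattern // v ≠ u ∧ dist (u : E3) v ≤ 11 / 10} = 4 := by
  have h := robustGood_four_contacts_hcp (p := 0) (d := 1) (η := 0) one_pos (by norm_num) (A := LinearIsometry.id)
    (t := fun u : ↥hcpKissingPattern => (u : E3)) (fun u => by simp) u
  simpa using h

/-! ## §2. Generic cores (pattern `Pat` with distance spectrum `{1} ∪ [√2, ∞)` and four contacts) -/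

section Cores

variable {M : ℕ} {z : Fin M → E3} {c : Fin M} {Pat : Finset E3} {d η η' γ : ℝ} {A : E3 →ₗᵢ[ℝ] E3} {t : ↥Pat → E3} {q₀ : ℝ}

/-- **The shell map is injective for every `η' < 1/2`** (pattern pairwise `≥ 1` apart). [folklore] -/
theorem shell_injective_loose (hPat1 : ∀ u ∈ Pat, ∀ v ∈ Pat, u ≠ v → 1 ≤ dist u v) (hd : 0 < d) (hη' : η' < 1 / 2)
    (ht : ∀ u : ↥Pat, ‖(t u - z c) - d • A (u : E3)‖ ≤ η' * d) : Function.Injective t := by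
  intro u v huv
  by_contra hne
  have h1 : 1 ≤ dist (u : E3) v := hPat1 u u.2 v v.2 fun h => hne (Subtype.ext h)
  have h2 := (abs_le.1 (dist_shell_sub_le hd.le ht u v)).1
  rw [huv, dist_self] at h2
  nlinarith

/-- **Loose dichotomy of shell distances**: contacts `≤ (1 + 2η')·d`, everything else `≥ (√2 − 2η')·d`. [folklore] -/
theorem shell_dichotomy_loose (hdich : ∀ u v : ↥Pat, u ≠ v → dist (u : E3) v = 1 ∨ Real.sqrt 2 ≤ dist (u : E3) v) (hd : 0 ≤ d)
    (ht : ∀ u : ↥Pat, ‖(t u - z c) - d • A (u : E3)‖ ≤ η' * d) (u v : ↥Pat) (huv : u ≠ v) :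
    (dist (u : E3) v = 1 ∧ dist (t u) (t v) ≤ (1 + 2 * η') * d) ∨
      (Real.sqrt 2 ≤ dist (u : E3) v ∧ (Real.sqrt 2 - 2 * η') * d ≤ dist (t u) (t v)) := by
  have hs := abs_le.1 (dist_shell_sub_le hd ht u v)
  rcases hdich u v huv with h | h
  · left
    refine ⟨h, ?_⟩
    rw [h] at hs
    linarith [hs.2]
  · right
    refine ⟨h, ?_⟩
    have := mul_le_mul_of_nonneg_left h hd
    linarith [hs.1]

/-- ELEVEN core at loose tolerance (`η' < 3/10`, so that the shell stays below `13/10·d`). [folklore] -/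
theorem eleven_core_loose (hz : Function.Injective z) (hcard : Pat.card = 12) (hPatn : ∀ u ∈ Pat, ‖u‖ = 1)
    (hPat1 : ∀ u ∈ Pat, ∀ v ∈ Pat, u ≠ v → 1 ≤ dist u v) (hd : 0 < d) (hη' : η' < 3 / 10)
    (ht : ∀ u : ↥Pat, t u ∈ Set.range z ∧ ‖(t u - z c) - d • A (u : E3)‖ ≤ η' * d)
    (h1 : ∀ s : E3, s ∈ Set.range z → s ≠ z c → d ≤ dist s (z c)) {a₁ : Fin M} (ha₁ : a₁ ≠ c)
    (L : Finset (Fin M)) (h11 : L.card < 12) (hcov : ∀ a, a ≠ c → dist (z a) (z c) ^ 2 < 169 / 100 * dist (z a₁) (z c) ^ 2 → a ∈ L) :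
    False := by
  have htinj := shell_injective_loose hPat1 hd (hη'.trans (by norm_num)) fun u => (ht u).2
  have hda₁ := scale_le_dist hz h1 ha₁
  have hidx : ∀ u : ↥Pat, ∃ a : Fin M, a ∈ L ∧ z a = t u := by
    intro u
    obtain ⟨a, ha⟩ := (ht u).1
    have hrad := radial_window hPatn hd.le (fun u => (ht u).2) u
    have hac : a ≠ c := by
      rintro rfl
      have h := hrad.1
      rw [← ha, dist_self] at h
      nlinarith
    refine ⟨a, hcov a hac ?_, ha⟩
    rw [ha]
    have hlt : dist (t u) (z c) < 13 / 10 * dist (z a₁) (z c) := by nlinarith [hrad.2]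
    have hsq := pow_lt_pow_left₀ hlt dist_nonneg two_ne_zero
    rw [mul_pow] at hsq
    norm_num at hsq
    linarith
  choose f hfL hfz using hidx
  have hinj : Function.Injective f := fun u v huv => htinj (by rw [← hfz u, ← hfz v, huv])
  have hle : Pat.card ≤ L.card := by
    have h := Finset.card_le_card_of_injOn (s := (Finset.univ : Finset ↥Pat)) (t := L) f (fun u _ => hfL u) hinj.injOn
    simpa using h
  omega

/-- FIVE-CLOSE core (any `η'` with `2η' < s ≤ √2`… precisely `s² ≤ 2`, `2η' < s`… we use `η' < η`, `2η ≤ s`): five first-shell atoms closer than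
`(s − 2η)·√q₀` to a first-shell atom are five pattern contacts of a `4`-regular pattern. [folklore] -/
theorem fiveClose_core (hz : Function.Injective z)
    (hdich : ∀ u v : ↥Pat, u ≠ v → dist (u : E3) v = 1 ∨ Real.sqrt 2 ≤ dist (u : E3) v)
    (hfour : ∀ u : ↥Pat, Nat.card {v : ↥Pat // v ≠ u ∧ dist (u : E3) v ≤ 11 / 10} = 4) (hd : 0 < d) (hγ : 0 < γ) (hη' : η' < η)
    (ht : ∀ u : ↥Pat, t u ∈ Set.range z ∧ ‖(t u - z c) - d • A (u : E3)‖ ≤ η' * d)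
    (h2 : ∃ s : E3, s ∈ Set.range z ∧ s ≠ z c ∧ dist s (z c) ≤ d)
    (hgap : ∀ s : E3, s ∈ Set.range z → s ≠ z c → dist s (z c) < 13 / 10 * d + γ → dist s (z c) ≤ 13 / 10 * d - γ ∧ s ∈ Set.range t)
    (hq₀ : ∀ a, a ≠ c → q₀ ≤ dist (z a) (z c) ^ 2) {s : ℝ} (hs2 : s ^ 2 ≤ 2) (hηs : 2 * η ≤ s)
    {j : Fin M} (hj : j ≠ c) (hjd : dist (z j) (z c) ^ 2 < 169 / 100 * q₀)
    (K : Finset (Fin M)) (h5 : 4 < K.card) (hjK : j ∉ K) (hcK : c ∉ K)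
    (hK : ∀ k ∈ K, dist (z k) (z c) ^ 2 < 169 / 100 * q₀ ∧ dist (z j) (z k) ^ 2 < (s - 2 * η) ^ 2 * q₀) : False := by
  classical
  have hq₀d := lower_le_scale_sq hq₀ h2
  obtain ⟨u₀, hu₀⟩ := mem_range_of_sq_lt hz hq₀d hd.le hγ hgap hj hjd
  have hssqrt : s ≤ Real.sqrt 2 := Real.le_sqrt_of_sq_le hs2
  have hcon : ∀ k : ↥K, ∃ v : ↥Pat, v ≠ u₀ ∧ dist (u₀ : E3) v ≤ 11 / 10 ∧ t v = z k := by
    intro k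
    have hkc : (k : Fin M) ≠ c := fun h => hcK (h ▸ k.2)
    obtain ⟨v, hv⟩ := mem_range_of_sq_lt hz hq₀d hd.le hγ hgap hkc (hK k k.2).1
    have hvu : v ≠ u₀ := by
      rintro rfl
      exact hjK ((hz (hu₀.symm.trans hv)) ▸ k.2)
    refine ⟨v, hvu, ?_, hv⟩
    rcases shell_dichotomy_loose hdich hd.le (fun u => (ht u).2) u₀ v hvu.symm with ⟨h, -⟩ | ⟨-, h⟩
    · rw [h]; norm_num
    · exfalso
      rw [hu₀, hv] at h
      -- `(s − 2η)·d ≤ (√2 − 2η')·d ≤ dist (z j) (z k)`, squared, against `hK`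
      have hle : (s - 2 * η) * d ≤ dist (z j) (z k) := by nlinarith
      have h0 : 0 ≤ (s - 2 * η) * d := by nlinarith
      have hsq := pow_le_pow_left₀ h0 hle 2
      rw [mul_pow] at hsq
      have h0' : 0 ≤ (s - 2 * η) ^ 2 := sq_nonneg _
      nlinarith [(hK k k.2).2, mul_le_mul_of_nonneg_left hq₀d h0']
  choose f hf1 hf2 hf3 using hcon
  let F : ↥K → {v : ↥Pat // v ≠ u₀ ∧ dist (u₀ : E3) v ≤ 11 / 10} := fun k => ⟨f k, hf1 k, hf2 k⟩
  have hinj : Function.Injective F := by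
    intro k k' h
    have h' : f k = f k' := congrArg Subtype.val h
    exact Subtype.ext (hz (by rw [← hf3 k, ← hf3 k', h']))
  have hle := Nat.card_le_card_of_injective F hinj
  rw [hfour u₀, Nat.card_eq_fintype_card, Fintype.card_coe] at hle
  omega

/-- FEW-CONTACTS core (`η ≤ 3/10`): the four pattern contacts of `j`'s preimage land at squared distance `≤ (1 + 2η)²·|z a₁ − z c|²` from `z j`, at
covered indices `≠ j`. [folklore] -/
theorem fewContacts_core (hz : Function.Injective z) (hPatn : ∀ u ∈ Pat, ‖u‖ = 1) (hPat1 : ∀ u ∈ Pat, ∀ v ∈ Pat, u ≠ v → 1 ≤ dist u v)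
    (hdich : ∀ u v : ↥Pat, u ≠ v → dist (u : E3) v = 1 ∨ Real.sqrt 2 ≤ dist (u : E3) v)
    (hfour : ∀ u : ↥Pat, Nat.card {v : ↥Pat // v ≠ u ∧ dist (u : E3) v ≤ 11 / 10} = 4) (hne : Pat.Nonempty) (hd : 0 < d) (hγ : 0 < γ)
    (hη' : η' < η) (hη : η ≤ 3 / 10)
    (ht : ∀ u : ↥Pat, t u ∈ Set.range z ∧ ‖(t u - z c) - d • A (u : E3)‖ ≤ η' * d)
    (h1 : ∀ s : E3, s ∈ Set.range z → s ≠ z c → d ≤ dist s (z c)) (h2 : ∃ s : E3, s ∈ Set.range z ∧ s ≠ z c ∧ dist s (z c) ≤ d)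
    (hgap : ∀ s : E3, s ∈ Set.range z → s ≠ z c → dist s (z c) < 13 / 10 * d + γ → dist s (z c) ≤ 13 / 10 * d - γ ∧ s ∈ Set.range t)
    (hq₀ : ∀ a, a ≠ c → q₀ ≤ dist (z a) (z c) ^ 2) {a₁ : Fin M} (ha₁ : a₁ ≠ c)
    (L : Finset (Fin M)) (hcov : ∀ a, a ≠ c → dist (z a) (z c) ^ 2 < 169 / 100 * dist (z a₁) (z c) ^ 2 → a ∈ L)
    {j : Fin M} (hj : j ≠ c) (hjd : dist (z j) (z c) ^ 2 < 169 / 100 * q₀)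
    (hfew : (L.filter fun k => k ≠ j ∧ dist (z j) (z k) ^ 2 ≤ (1 + 2 * η) ^ 2 * dist (z a₁) (z c) ^ 2).card < 4) : False := by
  classical
  have hη'0 := eta_nonneg hd hne fun u => (ht u).2
  have htinj := shell_injective_loose hPat1 hd ((hη'.trans_le hη).trans (by norm_num)) fun u => (ht u).2
  have hq₀d := lower_le_scale_sq hq₀ h2
  have hda₁ := scale_le_dist hz h1 ha₁
  obtain ⟨u₀, hu₀⟩ := mem_range_of_sq_lt hz hq₀d hd.le hγ hgap hj hjd
  -- every pattern contact `v` of `u₀` gives a covered index in the filter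
  have hidx : ∀ v : {v : ↥Pat // v ≠ u₀ ∧ dist (u₀ : E3) v ≤ 11 / 10}, ∃ k : Fin M,
      k ∈ L.filter (fun k => k ≠ j ∧ dist (z j) (z k) ^ 2 ≤ (1 + 2 * η) ^ 2 * dist (z a₁) (z c) ^ 2) ∧ z k = t v.1 := by
    rintro ⟨v, hvu, hvd⟩
    obtain ⟨k, hk⟩ := (ht v).1
    have hrad := radial_window hPatn hd.le (fun u => (ht u).2) v
    have hkc : k ≠ c := by
      rintro rfl
      have h := hrad.1
      rw [← hk, dist_self] at h
      nlinarith
    refine ⟨k, Finset.mem_filter.2 ⟨hcov k hkc ?_, ?_, ?_⟩, hk⟩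
    · rw [hk]
      have hlt : dist (t v) (z c) < 13 / 10 * dist (z a₁) (z c) := by nlinarith [hrad.2]
      have hsq := pow_lt_pow_left₀ hlt dist_nonneg two_ne_zero
      rw [mul_pow] at hsq
      norm_num at hsq
      linarith
    · intro hkj
      apply hvu
      exact htinj (by rw [← hk, hkj, ← hu₀])
    · have hdist1 : dist (u₀ : E3) v = 1 := by
        rcases hdich u₀ v hvu.symm with h | h
        · exact h
        · exfalso
          have hsq2 : (11 : ℝ) / 10 < Real.sqrt 2 := by
            rw [show (11 : ℝ) / 10 = Real.sqrt ((11 / 10) ^ 2) from (Real.sqrt_sq (by norm_num)).symm]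
            exact Real.sqrt_lt_sqrt (by norm_num) (by norm_num)
          linarith
      have hs := (abs_le.1 (dist_shell_sub_le hd.le (fun u => (ht u).2) u₀ v)).2
      rw [hdist1, hu₀, ← hk] at hs
      have hle : dist (z j) (z k) ≤ (1 + 2 * η) * dist (z a₁) (z c) := by nlinarith
      have := pow_le_pow_left₀ dist_nonneg hle 2
      rwa [mul_pow] at this
  choose f hfL hfz using hidx
  have hinj : Function.Injective f := by
    intro v v' h
    apply Subtype.ext
    exact htinj (by rw [← hfz v, ← hfz v', h])
  have hle : Nat.card {v : ↥Pat // v ≠ u₀ ∧ dist (u₀ : E3) v ≤ 11 / 10} ≤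
      (L.filter fun k => k ≠ j ∧ dist (z j) (z k) ^ 2 ≤ (1 + 2 * η) ^ 2 * dist (z a₁) (z c) ^ 2).card := by
    have h := Finset.card_le_card_of_injOn (s := (Finset.univ : Finset {v : ↥Pat // v ≠ u₀ ∧ dist (u₀ : E3) v ≤ 11 / 10}))
      (t := L.filter fun k => k ≠ j ∧ dist (z j) (z k) ^ 2 ≤ (1 + 2 * η) ^ 2 * dist (z a₁) (z c) ^ 2) f (fun v _ => hfL v) hinj.injOn
    rw [Finset.card_univ, ← Nat.card_eq_fintype_card] at h
    exact h
  rw [hfour u₀] at hle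
  omega

end Cores

/-! ## §3. The certificates for the two kissing patterns -/

section Badness

variable {M : ℕ} {z : Fin M → E3} {c : Fin M} {η q₀ : ℝ}

/-- ★ **ELEVEN-NEIGHBOURS badness certificate at loose tolerance** (`η ≤ 3/10`). [folklore] -/
theorem not_goodAt_of_eleven_loose (hz : Function.Injective z) (hη : η ≤ 3 / 10) {a₁ : Fin M} (ha₁ : a₁ ≠ c) (L : Finset (Fin M))
    (h11 : L.card < 12) (hcov : ∀ a, a ≠ c → dist (z a) (z c) ^ 2 < 169 / 100 * dist (z a₁) (z c) ^ 2 → a ∈ L) : ¬ GoodAt η z c := by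
  rintro ⟨d, η', γ, A, hor⟩
  rcases hor with ⟨t, hd, -, hη', ht, h1, -, -⟩ | ⟨t, hd, -, hη', ht, h1, -, -⟩
  · exact eleven_core_loose hz card_fccKissingPattern (fun u hu => norm_eq_one_of_mem_fccKissingPattern hu)
      (fun u hu v hv huv => one_le_dist_of_mem_fccKissingPattern hu hv huv) hd (hη'.trans_le hη) ht h1 ha₁ L h11 hcov
  · exact eleven_core_loose hz card_hcpKissingPattern (fun u hu => norm_eq_one_of_mem_hcpKissingPattern hu)
      (fun u hu v hv huv => one_le_dist_of_mem_hcpKissingPattern hu hv huv) hd (hη'.trans_le hη) ht h1 ha₁ L h11 hcov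

/-- ★ **FIVE-CLOSE badness certificate** (any `η`; `s` a rational with `s² ≤ 2`, `2η ≤ s`): a first-shell atom `j ≠ c` and a set `K` of five further
first-shell atoms (`j, c ∉ K`), each at squared distance `< (s − 2η)²·q₀` from `z j` ⟹ `¬ GoodAt η z c`.  (At `η = 1/8`, `s = 7/5`: threshold
`(23/20)²·q₀`; the icosahedral shell's five contacts at `1.0515·d` qualify.) [folklore] -/
theorem not_goodAt_of_fiveClose (hz : Function.Injective z) (hq₀ : ∀ a, a ≠ c → q₀ ≤ dist (z a) (z c) ^ 2) {s : ℝ} (hs2 : s ^ 2 ≤ 2)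
    (hηs : 2 * η ≤ s) {j : Fin M} (hj : j ≠ c) (hjd : dist (z j) (z c) ^ 2 < 169 / 100 * q₀) (K : Finset (Fin M)) (h5 : 4 < K.card)
    (hjK : j ∉ K) (hcK : c ∉ K) (hK : ∀ k ∈ K, dist (z k) (z c) ^ 2 < 169 / 100 * q₀ ∧ dist (z j) (z k) ^ 2 < (s - 2 * η) ^ 2 * q₀) :
    ¬ GoodAt η z c := by
  rintro ⟨d, η', γ, A, hor⟩
  rcases hor with ⟨t, hd, hγ, hη', ht, -, h2, hgap⟩ | ⟨t, hd, hγ, hη', ht, -, h2, hgap⟩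
  · exact fiveClose_core hz fcc_dist_one_or_sqrt_two_le fcc_four_contacts hd hγ hη' ht h2 hgap hq₀ hs2 hηs hj hjd K h5 hjK hcK hK
  · exact fiveClose_core hz hcp_dist_one_or_sqrt_two_le hcp_four_contacts hd hγ hη' ht h2 hgap hq₀ hs2 hηs hj hjd K h5 hjK hcK hK

/-- ★ **FEW-CONTACTS badness certificate** (`η ≤ 3/10`): `L` covers every `a ≠ c` with `|z a − z c|² < 169/100·|z a₁ − z c|²`; a first-shell atom
`j ≠ c` (`|z j − z c|² < 169/100·q₀`) has fewer than four indices `k ∈ L`, `k ≠ j`, with `|z j − z k|² ≤ (1 + 2η)²·|z a₁ − z c|²`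
⟹ `¬ GoodAt η z c` (a stretched or missing contact). [folklore] -/
theorem not_goodAt_of_fewContacts (hz : Function.Injective z) (hη : η ≤ 3 / 10) (hq₀ : ∀ a, a ≠ c → q₀ ≤ dist (z a) (z c) ^ 2)
    {a₁ : Fin M} (ha₁ : a₁ ≠ c) (L : Finset (Fin M))
    (hcov : ∀ a, a ≠ c → dist (z a) (z c) ^ 2 < 169 / 100 * dist (z a₁) (z c) ^ 2 → a ∈ L) {j : Fin M} (hj : j ≠ c)
    (hjd : dist (z j) (z c) ^ 2 < 169 / 100 * q₀)
    (hfew : (L.filter fun k => k ≠ j ∧ dist (z j) (z k) ^ 2 ≤ (1 + 2 * η) ^ 2 * dist (z a₁) (z c) ^ 2).card < 4) : ¬ GoodAt η z c := by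
  rintro ⟨d, η', γ, A, hor⟩
  rcases hor with ⟨t, hd, hγ, hη', ht, h1, h2, hgap⟩ | ⟨t, hd, hγ, hη', ht, h1, h2, hgap⟩
  · exact fewContacts_core hz (fun u hu => norm_eq_one_of_mem_fccKissingPattern hu)
      (fun u hu v hv huv => one_le_dist_of_mem_fccKissingPattern hu hv huv) fcc_dist_one_or_sqrt_two_le fcc_four_contacts
      fccKissingPattern_nonempty hd hγ hη' hη ht h1 h2 hgap hq₀ ha₁ L hcov hj hjd hfew
  · exact fewContacts_core hz (fun u hu => norm_eq_one_of_mem_hcpKissingPattern hu)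
      (fun u hu v hv huv => one_le_dist_of_mem_hcpKissingPattern hu hv huv) hcp_dist_one_or_sqrt_two_le hcp_four_contacts
      hcpKissingPattern_nonempty hd hγ hη' hη ht h1 h2 hgap hq₀ ha₁ L hcov hj hjd hfew

end Badness

end Summit.AtomisticToContinuum.Crystallization.Theorems.FrustratedLawDichotomyShellBadnessCertLoose

end
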